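import Literature.IUT.LogVolume.TensorPacketStepV
import Literature.IUT.LogVolume.TensorPacketModelScaled
import HarnessLib

/-!
# [IUTchIV] Thm. 1.10 Steps (v)–(vi) per summand in the real tensor packet with a GENERAL shell normalisation
# (`realPrimePacketWith`, in particular Mochizuki's container `realPrimePacketM`)

Sequel to `TensorPacketStepV.lean` (same statements, same proofs) for abc-iut-c312-3's `realPrimePacketWith p 𝔽 c`
(`TensorPacketModelScaled.lean`): the real packet whose log-shell slot is `c(v⃗)·log_p(R_I^×)` for a nonzero
slot-symmetric scalar `c` — `c = (2p)^{−|I|}` is Dupuy–Hilado's `I_{v⃗}` (`realPrimePacket`, definitionally), `c =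
p^{−⌈d_I+a_I⌉}` is Mochizuki's Step (v) container (`realPrimePacketM`; [IUTchIV] Prop. 1.2 (ii) "In particular").
The per-summand Step (v)/(vi) bounds never read the shell, so they hold verbatim for every `c`; the point of the
general form is that for `realPrimePacketM` the SHARP (Ind3)-datum `O_𝕃(−P_Θ)` EXISTS (c312-3 `minimalDHDatumM`,
`DHData.ofIdelesM`), whereas with Dupuy–Hilado's normalisation no (Ind3)-datum exists at wildly ramified tuples
(HOME/plan/c312/R7C3Q1-COMPUTATION.md). Mochizuki, *IUT IV* (RIMS ms Apr. 2020), proof of Thm. 1.10, Step (v)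
p. 27–28, Step (vi) p. 29; Dupuy–Hilado, arXiv:2004.13228, §3.9, §4.7, §4.9–4.12.
[cite: Mochizuki2012, IUTchIV Thm 1.10 proof Step (v) p.27–28, Step (vi) p.29] [cite: DupuyHilado2025, §3.9, §4.7, §4.9, §4.11, §4.12]
THEOREMS ONLY (abc-iut cell, seat abc-iut-c312-d1); no side taken on [IUTchIII] Cor. 3.12; typed ≠ endorsed.
-/

noncomputable section

open Set MeasureTheory NumberField IsDedekindDomain
open scoped Pointwise TensorProduct

namespace Literature.IUT.LogVolume

section RealPacketWith

variable {F : Type} [Field F] [NumberField F]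
variable (p : ℕ) [Fact p.Prime] (𝔽 : LocalFields F p)
variable (c : (j : ℕ) → (Fin (j + 1) → placesOver F p) → ℚ_[p]) (hc0 : ∀ j e, c j e ≠ 0)
  (hcσ : ∀ (j : ℕ) (σ : Equiv.Perm (Fin (j + 1))) (e : Fin (j + 1) → placesOver F p), c j (e ∘ σ) = c j e)

/-- The summand's integral structure IS `(R_I)^∼` (any shell normalisation). [cite: DupuyHilado2025, §2.4.5] -/
theorem realPrimePacketWith_O' (j : ℕ) (e : Fin (j + 1) → placesOver F p) :
    (realPrimePacketWith p 𝔽 c hc0 hcσ).O j e =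
      (normalizedPacket p (fun i => 𝔽.k (e i)) : Set (PacketAlgebra p (fun i => 𝔽.k (e i)))) := rfl

/-- The peel action IS multiplication by `ι_j(a)`: `peel a '' U = ι_j(a)·U` (any shell normalisation).
[cite: DupuyHilado2025, §3.7] -/
theorem realPrimePacketWith_peel_image' {j : ℕ} {e : Fin (j + 1) → placesOver F p}
    (a : (𝔽.k (e (Fin.last j)))ˣ) (U : Set (PacketAlgebra p (fun i => 𝔽.k (e i)))) :
    (realPrimePacketWith p 𝔽 c hc0 hcσ).peel a '' U =
      iota p (fun i => 𝔽.k (e i)) (Fin.last j) (a : 𝔽.k (e (Fin.last j))) • U := by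
  rw [← Set.image_smul]
  rfl


/-- **The (Ind1)-transport of the bare region of a permuted summand**: in the real packet,
`perm_σ(t·O_{v⃗∘σ}) = ι_{σ(j)}(t)·(R_I)^∼_{v⃗}` for the scalar `t ∈ (fun i => 𝔽.k (e i))^×_{v̲_{σ(j)}}` read at the LAST place of
`v⃗ ∘ σ` (Dupuy–Hilado §3.9 twists through the last factor; §4.7 moves the factors).
[cite: DupuyHilado2025, §3.9, §4.7] -/
theorem realPrimePacketWith_perm_image_bare {j : ℕ} (σ : Equiv.Perm (Fin (j + 1)))
    (e : Fin (j + 1) → placesOver F p) (t : (𝔽.k (e (σ (Fin.last j))))ˣ) :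
    (realPrimePacketWith p 𝔽 c hc0 hcσ).perm σ e ''
        ((realPrimePacketWith p 𝔽 c hc0 hcσ).peel t '' (realPrimePacketWith p 𝔽 c hc0 hcσ).O j (e ∘ σ)) =
      iota p (fun i => 𝔽.k (e i)) (σ (Fin.last j)) (t : 𝔽.k (e (σ (Fin.last j)))) •
        (normalizedPacket p (fun i => 𝔽.k (e i)) : Set (PacketAlgebra p (fun i => 𝔽.k (e i)))) := by
  rw [realPrimePacketWith_peel_image', realPrimePacketWith_O']
  exact image_permAlgEquiv_iota_smul_normalizedPacket p (fun i => 𝔽.k (e i)) σ (Fin.last j) (t : _)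

/-- **The local orbit lies in the slot-union.** In the real packet, for theta values `t_v ∈ (fun i => 𝔽.k (e i))^×_{v̲}` at the
places over `p` and (Ind3)-data `B_σ ⊆ t_{v_{σ(j)}}·O_{v⃗∘σ}` on the permuted summands (the SHARP reading of
(Ind3)), every `g·perm_σ(B_σ)` (`g` in the (Ind2)-group of `v⃗`) lies in `⋃_i autImages(ι_i(t_{v_i})·(R_I)^∼)`.
[cite: DupuyHilado2025, §4.7, §4.9, §4.11] -/
theorem realPrimePacketWith_localUnion_subset_slotUnion {j : ℕ} (e : Fin (j + 1) → placesOver F p)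
    (t : ∀ v : placesOver F p, (𝔽.k v)ˣ)
    (B : (realPrimePacketWith p 𝔽 c hc0 hcσ).Region)
    (hB : ∀ σ : Equiv.Perm (Fin (j + 1)),
      B j (e ∘ σ) ⊆ (realPrimePacketWith p 𝔽 c hc0 hcσ).peel (t (e (σ (Fin.last j)))) '' (realPrimePacketWith p 𝔽 c hc0 hcσ).O j (e ∘ σ)) :
    (⋃ (g : (realPrimePacketWith p 𝔽 c hc0 hcσ).G₂ j e) (σ : Equiv.Perm (Fin (j + 1))),
        g • ((realPrimePacketWith p 𝔽 c hc0 hcσ).perm σ e '' B j (e ∘ σ))) ⊆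
      ⋃ i, autImages p (fun i => 𝔽.k (e i))
        (iota p (fun i => 𝔽.k (e i)) i (t (e i) : 𝔽.k (e i)) •
          (normalizedPacket p (fun i => 𝔽.k (e i)) : Set (PacketAlgebra p (fun i => 𝔽.k (e i))))) := by
  refine Set.iUnion₂_subset fun g σ => ?_
  have h1 : (realPrimePacketWith p 𝔽 c hc0 hcσ).perm σ e '' B j (e ∘ σ) ⊆
      iota p (fun i => 𝔽.k (e i)) (σ (Fin.last j)) (t (e (σ (Fin.last j))) : _) •
        (normalizedPacket p (fun i => 𝔽.k (e i)) : Set (PacketAlgebra p (fun i => 𝔽.k (e i)))) := by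
    rw [← realPrimePacketWith_perm_image_bare p 𝔽 c hc0 hcσ σ e (t (e (σ (Fin.last j))))]
    exact Set.image_mono (hB σ)
  refine (Set.smul_set_mono h1).trans ((indTwo_smul_subset_autImages p _ g _).trans ?_)
  exact Set.subset_iUnion (fun i => autImages p (fun i => 𝔽.k (e i))
    (iota p (fun i => 𝔽.k (e i)) i (t (e i) : 𝔽.k (e i)) •
      (normalizedPacket p (fun i => 𝔽.k (e i)) : Set (PacketAlgebra p (fun i => 𝔽.k (e i)))))) (σ (Fin.last j))

/-- **Step (v) per summand, in the real packet.** Degree `j ≥ 1`, summand `v⃗ = (v_0,…,v_j)`, theta values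
`t_v ∈ (fun i => 𝔽.k (e i))^×_{v̲}`, SHARP (Ind3)-data `B_σ ⊆ t_{v_{σ(j)}}·O_{v⃗∘σ}` with `t_{v_j}·O_{v⃗} ⊆ B_1`, [IUTchIV] Prop. 1.2 (ii)
for the packet (`Prop12ii`), `I* ⊆` the slots off which `e_i ≤ p − 2`, and a slot `i₀` of largest norm
`‖t_{v_{i₀}}‖` (least order `λ_min`). Then the hull of the local (Ind2)·(Ind1)-orbit `U` of the data is admissible and
`log μ̄(hull U) − log μ̄(t_{v_j}·O_{v⃗}) ≤ {log‖t_{v_{i₀}}‖ − log‖t_{v_j}‖} + {d_I + 1}·log(p) + Σ_{i∈I*}{3 + log(e_i)}`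
— i.e. `{λ_j − λ_min + d_I + 1}·log(p) + Σ_{i∈I*}{3 + log(e_i)}`, the text's `{d_I + 1}·log(p) + Σ…` plus the
(Ind1)-slot term (zero for slot-constant orders). [cite: Mochizuki2012, IUTchIV Thm 1.10 proof Step (v) p.27–28] -/
theorem realPrimePacketWith_stepV {j : ℕ} (hj : 1 ≤ j) (e : Fin (j + 1) → placesOver F p)
    (h12 : Prop12ii p (fun i => 𝔽.k (e i)))
    (t : ∀ v : placesOver F p, (𝔽.k v)ˣ)
    (B : (realPrimePacketWith p 𝔽 c hc0 hcσ).Region)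
    (hB : ∀ σ : Equiv.Perm (Fin (j + 1)),
      B j (e ∘ σ) ⊆ (realPrimePacketWith p 𝔽 c hc0 hcσ).peel (t (e (σ (Fin.last j)))) '' (realPrimePacketWith p 𝔽 c hc0 hcσ).O j (e ∘ σ))
    (hB1 : (realPrimePacketWith p 𝔽 c hc0 hcσ).peel (t (e (Fin.last j))) '' (realPrimePacketWith p 𝔽 c hc0 hcσ).O j e ⊆ B j e)
    (Istar : Finset (Fin (j + 1)))
    (htame : ∀ i, i ∉ Istar → absRamificationIdx p (𝔽.k (e i)) ≤ p - 2)
    (i₀ : Fin (j + 1)) (hmax : ∀ i, ‖(t (e i) : 𝔽.k (e i))‖ ≤ ‖(t (e i₀) : 𝔽.k (e i₀))‖) :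
    PacketAdm p (fun i => 𝔽.k (e i)) (packetHull p (fun i => 𝔽.k (e i))
        (⋃ (g : (realPrimePacketWith p 𝔽 c hc0 hcσ).G₂ j e) (σ : Equiv.Perm (Fin (j + 1))),
          g • ((realPrimePacketWith p 𝔽 c hc0 hcσ).perm σ e '' B j (e ∘ σ)))) ∧
      packetLogμ p (fun i => 𝔽.k (e i)) (packetHull p (fun i => 𝔽.k (e i))
            (⋃ (g : (realPrimePacketWith p 𝔽 c hc0 hcσ).G₂ j e) (σ : Equiv.Perm (Fin (j + 1))),
              g • ((realPrimePacketWith p 𝔽 c hc0 hcσ).perm σ e '' B j (e ∘ σ))))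
          - packetLogμ p (fun i => 𝔽.k (e i))
              ((realPrimePacketWith p 𝔽 c hc0 hcσ).peel (t (e (Fin.last j))) '' (realPrimePacketWith p 𝔽 c hc0 hcσ).O j e)
        ≤ (Real.log ‖(t (e i₀) : 𝔽.k (e i₀))‖ - Real.log ‖(t (e (Fin.last j)) : 𝔽.k (e (Fin.last j)))‖)
            + (dSum p (fun i => 𝔽.k (e i)) + 1) * Real.log p
            + ∑ i ∈ Istar, (3 + Real.log (absRamificationIdx p (𝔽.k (e i)))) := by
  set U : Set (PacketAlgebra p (fun i => 𝔽.k (e i))) :=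
    ⋃ (g : (realPrimePacketWith p 𝔽 c hc0 hcσ).G₂ j e) (σ : Equiv.Perm (Fin (j + 1))),
      g • ((realPrimePacketWith p 𝔽 c hc0 hcσ).perm σ e '' B j (e ∘ σ)) with hU
  have hI : 2 ≤ Fintype.card (Fin (j + 1)) := by rw [Fintype.card_fin]; omega
  haveI : Nonempty (Fin (j + 1)) := ⟨0⟩
  -- slot data: orders `m_i` with `‖t_{v_i}‖ = p^{−m_i/e_i}`
  have ht0 : ∀ i, (t (e i) : (fun i => 𝔽.k (e i)) i) ≠ 0 := fun i => (t (e i)).ne_zero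
  choose m hm using fun i => exists_norm_eq_rpow p ((fun i => 𝔽.k (e i)) i) (ht0 i)
  have hmin : ∀ i, (m i₀ : ℝ) / absRamificationIdx p ((fun i => 𝔽.k (e i)) i₀) ≤ (m i : ℝ) / absRamificationIdx p ((fun i => 𝔽.k (e i)) i) :=
    fun i => slotOrder_le_of_norm_le p (fun i => 𝔽.k (e i)) (hm i) (hm i₀) (hmax i)
  obtain ⟨h, hh⟩ := exists_realizesNegB p (fun i => 𝔽.k (e i))
  -- the orbit lies in the slot-union, the bare region of `v⃗` lies in the orbit
  have hUu : U ⊆ ⋃ i, autImages p (fun i => 𝔽.k (e i)) (iota p (fun i => 𝔽.k (e i)) i (t (e i) : (fun i => 𝔽.k (e i)) i) • (normalizedPacket p (fun i => 𝔽.k (e i)) : Set (PacketAlgebra p (fun i => 𝔽.k (e i))))) :=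
    realPrimePacketWith_localUnion_subset_slotUnion p 𝔽 c hc0 hcσ e t B hB
  have hbare : (realPrimePacketWith p 𝔽 c hc0 hcσ).peel (t (e (Fin.last j))) '' (realPrimePacketWith p 𝔽 c hc0 hcσ).O j e =
      iota p (fun i => 𝔽.k (e i)) (Fin.last j) (t (e (Fin.last j)) : (fun i => 𝔽.k (e i)) (Fin.last j)) • (normalizedPacket p (fun i => 𝔽.k (e i)) : Set (PacketAlgebra p (fun i => 𝔽.k (e i)))) := by
    rw [realPrimePacketWith_peel_image', realPrimePacketWith_O']
  have hUl : iota p (fun i => 𝔽.k (e i)) (Fin.last j) (t (e (Fin.last j)) : (fun i => 𝔽.k (e i)) (Fin.last j)) •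
      (normalizedPacket p (fun i => 𝔽.k (e i)) : Set (PacketAlgebra p (fun i => 𝔽.k (e i)))) ⊆ U := by
    rw [← hbare]
    refine hB1.trans ?_
    have : B j e ⊆ (1 : (realPrimePacketWith p 𝔽 c hc0 hcσ).G₂ j e) • ((realPrimePacketWith p 𝔽 c hc0 hcσ).perm 1 e '' B j (e ∘ (1 : Equiv.Perm (Fin (j + 1))))) := by
      rw [one_smul]
      intro x hx
      exact ⟨x, hx, (realPrimePacketWith p 𝔽 c hc0 hcσ).perm_one e x⟩
    exact this.trans (Set.subset_iUnion₂ (s := fun (g : (realPrimePacketWith p 𝔽 c hc0 hcσ).G₂ j e)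
      (σ : Equiv.Perm (Fin (j + 1))) => g • ((realPrimePacketWith p 𝔽 c hc0 hcσ).perm σ e '' B j (e ∘ σ))) 1 1)
  -- the hull lies in the least slot's translate; admissibility and volume from S2's hull-volume lemmas
  have hUC := packetHull_subset_translate_of_subset_iUnion_autImages_slot h12 hI m
    (fun i => (t (e i) : (fun i => 𝔽.k (e i)) i)) hm h hh i₀ hmin hUu
  have hne := dEquiv_ppow_mul_purePacket_ne_zero p (fun i => 𝔽.k (e i))
    ⌊(m i₀ : ℝ) / absRamificationIdx p ((fun i => 𝔽.k (e i)) i₀) - dSum p (fun i => 𝔽.k (e i)) - aSum p (fun i => 𝔽.k (e i))⌋ (ne_zero_of_realizesNegB p (fun i => 𝔽.k (e i)) hh)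
  have hA : PacketAdm p (fun i => 𝔽.k (e i)) (iota p (fun i => 𝔽.k (e i)) (Fin.last j) (t (e (Fin.last j)) : (fun i => 𝔽.k (e i)) (Fin.last j)) •
      (normalizedPacket p (fun i => 𝔽.k (e i)) : Set (PacketAlgebra p (fun i => 𝔽.k (e i))))) :=
    packetAdm_iota_smul p (fun i => 𝔽.k (e i)) (Fin.last j) (ht0 _) (packetAdm_normalizedPacket p (fun i => 𝔽.k (e i)))
  have hHsub : packetHull p (fun i => 𝔽.k (e i)) U ⊆ _ := hUC
  refine ⟨packetAdm_of_subset_of_subset p (fun i => 𝔽.k (e i)) hA (packetAdm_smul_normalizedPacket p (fun i => 𝔽.k (e i)) _ hne)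
    (hUl.trans (subset_packetHull p (fun i => 𝔽.k (e i)) U)) hHsub, ?_⟩
  have hvol : packetLogμ p (fun i => 𝔽.k (e i)) (packetHull p (fun i => 𝔽.k (e i)) U) ≤
      (-((m i₀ : ℝ) / absRamificationIdx p ((fun i => 𝔽.k (e i)) i₀)) + dSum p (fun i => 𝔽.k (e i)) + 1) * Real.log p
        + ∑ i ∈ Istar, (3 + Real.log (absRamificationIdx p ((fun i => 𝔽.k (e i)) i))) :=
    (packetLogμ_mono p (fun i => 𝔽.k (e i))
        (packetAdm_of_subset_of_subset p (fun i => 𝔽.k (e i)) hA (packetAdm_smul_normalizedPacket p (fun i => 𝔽.k (e i)) _ hne)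
          (hUl.trans (subset_packetHull p (fun i => 𝔽.k (e i)) U)) hHsub)
        (packetAdm_smul_normalizedPacket p (fun i => 𝔽.k (e i)) _ hne) hHsub).trans
      (Prop14iii₂_holds p (fun i => 𝔽.k (e i)) (DFac p (fun i => 𝔽.k (e i))) (dEquiv p (fun i => 𝔽.k (e i))) hI Istar htame i₀ (m i₀) h hh)
  have hq : packetLogμ p (fun i => 𝔽.k (e i))
      ((realPrimePacketWith p 𝔽 c hc0 hcσ).peel (t (e (Fin.last j))) '' (realPrimePacketWith p 𝔽 c hc0 hcσ).O j e) =
      Real.log ‖(t (e (Fin.last j)) : 𝔽.k (e (Fin.last j)))‖ := by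
    have := packetLogμ_iota_smul_normalizedPacket p (fun i => 𝔽.k (e i)) (Fin.last j) (ht0 (Fin.last j))
    rw [← hbare] at this
    exact this
  rw [hq]
  have hl0 := (slot_ne_zero_and_log_norm p (fun i => 𝔽.k (e i)) (hm i₀)).2
  dsimp only at hvol hl0
  rw [hl0]
  linarith

/-- **Step (vi) per summand, in the real packet**: if every theta value over `p` is a UNIT, `p > 2`, every
`(fun i => 𝔽.k (e i))_{v̲_i}/ℚ_p` is unramified (so [IUTchIV] Prop. 1.2 (iv), hypothesis `Prop12iv`) and the (Ind3)-data of the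
permuted summands lie in `O` ("bare3 ⊆ O there"), then the hull of the local orbit has `log μ̄ ≤ 0
= log μ̄(O_{v⃗})`: the per-summand discrepancy VANISHES off the distinguished primes.
[cite: Mochizuki2012, IUTchIV Thm 1.10 proof Step (vi) p.29] -/
theorem realPrimePacketWith_stepVI {j : ℕ} (hj : 1 ≤ j) (e : Fin (j + 1) → placesOver F p) (hp : 2 < p)
    (h4 : Prop12iv p (fun i => 𝔽.k (e i))) (he : ∀ i, absRamificationIdx p (𝔽.k (e i)) = 1)
    (B : (realPrimePacketWith p 𝔽 c hc0 hcσ).Region)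
    (hB : ∀ σ : Equiv.Perm (Fin (j + 1)), B j (e ∘ σ) ⊆ (realPrimePacketWith p 𝔽 c hc0 hcσ).O j (e ∘ σ))
    (hB1 : (realPrimePacketWith p 𝔽 c hc0 hcσ).O j e ⊆ B j e) :
    PacketAdm p (fun i => 𝔽.k (e i)) (packetHull p (fun i => 𝔽.k (e i))
        (⋃ (g : (realPrimePacketWith p 𝔽 c hc0 hcσ).G₂ j e) (σ : Equiv.Perm (Fin (j + 1))),
          g • ((realPrimePacketWith p 𝔽 c hc0 hcσ).perm σ e '' B j (e ∘ σ)))) ∧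
      packetLogμ p (fun i => 𝔽.k (e i)) (packetHull p (fun i => 𝔽.k (e i))
        (⋃ (g : (realPrimePacketWith p 𝔽 c hc0 hcσ).G₂ j e) (σ : Equiv.Perm (Fin (j + 1))),
          g • ((realPrimePacketWith p 𝔽 c hc0 hcσ).perm σ e '' B j (e ∘ σ)))) ≤ 0 := by
  set U : Set (PacketAlgebra p (fun i => 𝔽.k (e i))) :=
    ⋃ (g : (realPrimePacketWith p 𝔽 c hc0 hcσ).G₂ j e) (σ : Equiv.Perm (Fin (j + 1))),
      g • ((realPrimePacketWith p 𝔽 c hc0 hcσ).perm σ e '' B j (e ∘ σ)) with hU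
  have hI : 2 ≤ Fintype.card (Fin (j + 1)) := by rw [Fintype.card_fin]; omega
  haveI : Nonempty (Fin (j + 1)) := ⟨0⟩
  -- every piece of the orbit is a possible image of a subset of `(R_I)^∼`
  have hUu : U ⊆ ⋃ σ : Equiv.Perm (Fin (j + 1)), autImages p (fun i => 𝔽.k (e i))
      ((realPrimePacketWith p 𝔽 c hc0 hcσ).perm σ e '' B j (e ∘ σ)) := by
    refine Set.iUnion₂_subset fun g σ => (indTwo_smul_subset_autImages p (fun i => 𝔽.k (e i)) g _).trans ?_
    exact Set.subset_iUnion (fun σ' : Equiv.Perm (Fin (j + 1)) =>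
      autImages p (fun i => 𝔽.k (e i)) ((realPrimePacketWith p 𝔽 c hc0 hcσ).perm σ' e '' B j (e ∘ σ'))) σ
  have hBO : ∀ σ : Equiv.Perm (Fin (j + 1)), (realPrimePacketWith p 𝔽 c hc0 hcσ).perm σ e '' B j (e ∘ σ) ⊆
      (normalizedPacket p (fun i => 𝔽.k (e i)) : Set (PacketAlgebra p (fun i => 𝔽.k (e i)))) := by
    intro σ
    refine (Set.image_mono (hB σ)).trans ?_
    rw [realPrimePacketWith_O']
    exact (image_normalizedPacket_perm p (fun i => 𝔽.k (e i)) σ).subset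
  have hH := packetHull_iUnion_autImages_subset_normalizedPacket h4 hI hp he _ hBO
  have hUl : (normalizedPacket p (fun i => 𝔽.k (e i)) : Set (PacketAlgebra p (fun i => 𝔽.k (e i)))) ⊆ U := by
    rw [← realPrimePacketWith_O' p 𝔽 c hc0 hcσ j e]
    refine hB1.trans ?_
    have : B j e ⊆ (1 : (realPrimePacketWith p 𝔽 c hc0 hcσ).G₂ j e) • ((realPrimePacketWith p 𝔽 c hc0 hcσ).perm 1 e '' B j (e ∘ (1 : Equiv.Perm (Fin (j + 1))))) := by
      rw [one_smul]
      intro x hx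
      exact ⟨x, hx, (realPrimePacketWith p 𝔽 c hc0 hcσ).perm_one e x⟩
    exact this.trans (Set.subset_iUnion₂ (s := fun (g : (realPrimePacketWith p 𝔽 c hc0 hcσ).G₂ j e)
      (σ : Equiv.Perm (Fin (j + 1))) => g • ((realPrimePacketWith p 𝔽 c hc0 hcσ).perm σ e '' B j (e ∘ σ))) 1 1)
  have hsub : packetHull p (fun i => 𝔽.k (e i)) U ⊆ (normalizedPacket p (fun i => 𝔽.k (e i)) : Set (PacketAlgebra p (fun i => 𝔽.k (e i)))) :=
    (packetHull_mono p (fun i => 𝔽.k (e i)) hUu).trans hH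
  have hadm : PacketAdm p (fun i => 𝔽.k (e i)) (packetHull p (fun i => 𝔽.k (e i)) U) :=
    packetAdm_of_subset_of_subset p (fun i => 𝔽.k (e i)) (packetAdm_normalizedPacket p (fun i => 𝔽.k (e i))) (packetAdm_normalizedPacket p (fun i => 𝔽.k (e i)))
      (hUl.trans (subset_packetHull p (fun i => 𝔽.k (e i)) U)) hsub
  refine ⟨hadm, ?_⟩
  rw [← packetLogμ_normalizedPacket p (fun i => 𝔽.k (e i))]
  exact packetLogμ_mono p (fun i => 𝔽.k (e i)) hadm (packetAdm_normalizedPacket p (fun i => 𝔽.k (e i))) hsub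

end RealPacketWith

end Literature.IUT.LogVolume

end
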